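import Mathlib
import HarnessLib
import HarnessLib.Audit
import Summits.Langlands.Statement
import Literature.NumberTheory.Automorphic.HilbertSiegelModularFormModN
import HarnessLib.Audit.Status.Attr

/-!
Route: TorsionKudlaMillsonWindow

# Route TorsionKudlaMillsonWindow — twisted class-number series of F-trace geodesics are mod-N
Hilbert–Siegel forms, giving Conjecture A over the quadratic window

It suffices to show X = `ConjAWindowTheta`: Calegari–Geraghty's Conjecture A at Satake level, in
degree 1, for the cocompact
arithmetic Kleinian groups Γ = O^×, O = O_K⟨1,i,j,k⟩ the coordinate order of a DIVISION quaternion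
algebra B = (a,b)_K over the
QUADRATIC WINDOW — F totally real, K/F quadratic with exactly one complex place, σ = Gal(K/F), a, b
∈ O_F ∖ 0 negative at the real
places of K (B ramified there) and not both negative at the real place σ₀ of F under the complex
place: for every finite commutative
ring A and every additive character c : Γ → A trivial on the centre O_K^× which is an eigenvector of
the Hecke operators T_v = [ΓgΓ]
(g ∈ O, g ḡ = ϖ, v = (ϖ) a principal prime of K with v ∤ 2ab|A|; double-coset action on Hom(Γ, A) =
H¹, Shimura1971 §8.3) there is a
locally constant 2-dimensional pseudo-representation (t, d) of Gal(K̄/K), unramified at these v,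
with T_v c = t(Frob_v)·c and
d(Frob_v) = q_v (arithmetic Frobenius). This realises card torsion-kudla-millson (gen 2: the gen-1
route TorsionKudlaMillson was retired
not-a-thesis); the engine towards X is the card's TORSION KUDLA–MILLSON conjecture, now TYPED over
the landed
`Literature.NumberTheory.Automorphic.hilbertSiegelModularFormModN` as the rank-2 crux, plus an exact
Hecke identity at inert primes (rank 3).
Lean: `∀ (F K : Type) [Field F] [NumberField F] [Field K] [NumberField K] [Algebra F K] (σ : K ≃ₐ[F]
K) (a b : NumberField.RingOfIntegers F), NumberField.IsTotallyReal F → Module.finrank F K = 2 → σ ≠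
1 → NumberField.InfinitePlace.nrComplexPlaces K = 1 → a ≠ 0 → b ≠ 0 → (∀ φ : K →+* ℂ, (starRingEnd
ℂ).comp φ = φ → (φ (algebraMap F K a)).re < 0 ∧ (φ (algebraMap F K b)).re < 0) → (∀ φ : K →+* ℂ,
(starRingEnd ℂ).comp φ ≠ φ → 0 < (φ (algebraMap F K a)).re ∨ 0 < (φ (algebraMap F K b)).re) → let a'
: K := algebraMap F K a; let b' : K := algebraMap F K b; (∀ y : QuaternionAlgebra K a' 0 b', y *
star y = 0 → y = 0) → let IsInt : QuaternionAlgebra K a' 0 b' → Prop := fun x => ∀ i : Fin 4,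
QuaternionAlgebra.equivTuple a' 0 b' x i ∈ Set.range (algebraMap (NumberField.RingOfIntegers K) K);
let IsG : (QuaternionAlgebra K a' 0 b')ˣ → Prop := fun u => IsInt (u : QuaternionAlgebra K a' 0 b')
∧ IsInt ((u⁻¹ : (QuaternionAlgebra K a' 0 b')ˣ) : QuaternionAlgebra K a' 0 b'); ∀ (A : Type)
[CommRing A] [Finite A], let HR : ((QuaternionAlgebra K a' 0 b')ˣ → A) → (QuaternionAlgebra K a' 0
b')ˣ → A → Prop := fun c g l => ∃ (k : ℕ) (r : Fin k → (QuaternionAlgebra K a' 0 b')ˣ), (∀ i, ∃ γ₁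
γ₂, IsG γ₁ ∧ IsG γ₂ ∧ r i = γ₁ * g * γ₂) ∧ (∀ γ₁ γ₂, IsG γ₁ → IsG γ₂ → ∃! i, ∃ γ, IsG γ ∧ γ₁ * g *
γ₂ = γ * r i) ∧ (∀ γ, IsG γ → ∀ (s : Fin k → Fin k) (e : Fin k → (QuaternionAlgebra K a' 0 b')ˣ), (∀
i, IsG (e i) ∧ r i * γ = e i * r (s i)) → ∑ i, c (e i) = l * c γ); let PR :
(Field.absoluteGaloisGroup K → A) → (Field.absoluteGaloisGroup K → A) → Prop := fun t d => t 1 = 2 ∧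
d 1 = 1 ∧ (∀ x y, d (x * y) = d x * d y) ∧ (∀ x y, t (x * y) = t (y * x)) ∧ (∀ x y, t x * t y = t (x
* y) + d y * t (x * y⁻¹)) ∧ IsLocallyConstant t ∧ IsLocallyConstant d; ∀ (c : (QuaternionAlgebra K
a' 0 b')ˣ → A), (∀ x y, IsG x → IsG y → c (x * y) = c x + c y) → (∀ u, IsG u → (u :
QuaternionAlgebra K a' 0 b') ∈ Set.range (algebraMap K (QuaternionAlgebra K a' 0 b')) → c u = 0) →
(∀ (ϖ : NumberField.RingOfIntegers K) (g : (QuaternionAlgebra K a' 0 b')ˣ) (v :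
IsDedekindDomain.HeightOneSpectrum (NumberField.RingOfIntegers K)), Prime ϖ → v.asIdeal = Ideal.span
{ϖ} → IsInt (g : QuaternionAlgebra K a' 0 b') → (g : QuaternionAlgebra K a' 0 b') * star (g :
QuaternionAlgebra K a' 0 b') = algebraMap K (QuaternionAlgebra K a' 0 b') (ϖ : K) → (2 * algebraMap
(NumberField.RingOfIntegers F) (NumberField.RingOfIntegers K) (a * b) * (Nat.card A :
NumberField.RingOfIntegers K)) ∉ v.asIdeal → ∃ l : A, HR c g l) → ∃ t d : Field.absoluteGaloisGroup
K → A, PR t d ∧ ∀ (ϖ : NumberField.RingOfIntegers K) (g : (QuaternionAlgebra K a' 0 b')ˣ) (v :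
IsDedekindDomain.HeightOneSpectrum (NumberField.RingOfIntegers K)), Prime ϖ → v.asIdeal = Ideal.span
{ϖ} → IsInt (g : QuaternionAlgebra K a' 0 b') → (g : QuaternionAlgebra K a' 0 b') * star (g :
QuaternionAlgebra K a' 0 b') = algebraMap K (QuaternionAlgebra K a' 0 b') (ϖ : K) → (2 * algebraMap
(NumberField.RingOfIntegers F) (NumberField.RingOfIntegers K) (a * b) * (Nat.card A :
NumberField.RingOfIntegers K)) ∉ v.asIdeal → ∀ 𝔓 ∈ v.primesAbove, (∀ τ ∈ 𝔓.inertia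
(Field.absoluteGaloisGroup K), ∀ s, t (s * τ) = t s ∧ d (s * τ) = d s) ∧ ∀ s, IsArithFrobAt
(NumberField.RingOfIntegers K) s 𝔓 → HR c g (t s) ∧ d s = (v.residueCard : A)`

## Assembly
Pure logic, sorry-free in the planner's Sketch.lean and in glue.lean: `closes tkm inert engine gen
eis dich beyond := beyond (dich (engine tkm
inert) gen eis)` — the engine completion turns TKM modularity + inert annihilation into Conj. A for
theta-visible characters, the
dichotomy glue adds the non-degeneracy and Eisenstein items to get X, and the declared residual
carries X to `Langlands`.

Rationale: WHY THIS LINE. Mechanism (card torsion-kudla-millson, host corrected in gen 1 to the quaternionic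
inner form): the F-trace loxodromic elements of Γ¹ are
exactly the pointwise stabilisers of totally positive F-rational 2-planes of the 4-dimensional
quadratic F-space V' = {y ∈ B : σ(y) = ȳ}
(signature (3,1) at σ₀, (4,0) elsewhere), i.e. the genus-2 Kudla–Millson special cycles = closed
geodesics of X = Γ¹\H³; with COMPLEX
coefficients the generating series of their classes paired with H¹ is a holomorphic Siegel(–Hilbert)
modular form of genus 2 and weight 2
(Kudla1981 for compact quotients of SO(n,1), KudlaMillson1990 Thm. 2; the theta dictionary GO(V') →
GSp₄/F of HarrisSoudryTaylor1993,
Roberts2001), and the pairing ⟨c, [C_T]⟩ = Σ c(holonomy) is purely topological, so it makes sense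
for c ∈ Hom(Γ, ℤ/N) — torsion and
non-congruence characters included. The thesis bets that modularity survives mod N (TKM, crux 2) and
Hecke-equivariantly (crux 3: at
primes of F inert in K the genus-2 T(ϖ) must ANNIHILATE the series, the torsion shadow of 'induced
from K'), so that torsion Galois
pseudo-representations of mod-p^m Hilbert–Siegel eigensystems over the totally real F (Taylor1991 in
char 0; Boxer2015 =
arXiv:1507.05922, GoldringKoskivirta2019, EmertonReduzziXiao2017 for torsion coherent classes)
descend to (t, d) over K (crux 4), for
fields K over which NO Shimura variety and no boundary trick is available (Calegari2023 §10;
CalegariVenkatesh2019 for compact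
3-manifolds over imaginary quadratic K). Imported areas: theta correspondence / special cycles
(orthogonal groups), arithmetic of
quaternion orders and Kleinian groups (VignerasLNM800), Hecke theory of Siegel theta series
(Yoshida1980, Andrianov2009), pseudo-representations
(Taylor1991). What is new w.r.t. gen 1 and every other Langlands route: the engine is no longer one
black-box crux — TKM and the inert
annihilation identity are typed statements a refuter can compute against, the Bianchi calibration
crux found trivially true by refuter
79b8ea41-0 is dropped, and the deciding theorem reaches `Langlands` through the declared residual
`BeyondTorsionWindow` (the pattern
accepted on route-Langlands-QuadraticWindow rev 3).

RANKED CRUXES. #0 ConjAWindowTheta (target) — X as in § Thesis (Conjecture A at Satake level, degree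
1, unit groups of coordinate orders of division quaternion algebras over the quadratic window,
characters trivial on the centre). Regimes: [F:ℚ] = 1 — compact arithmetic 3-manifolds over
imaginary quadratic K, OPEN (no Hecke-equivariant torsion Jacquet–Langlands); [F:ℚ] ≥ 2 — the window
proper, OPEN (Calegari2023 §10). The matrix/Bianchi case of gen 1 is excluded by the division
hypothesis (its calibration crux was trivially true). Follows by logic from ThetaVisibleConjA +
FTraceCongruenceGeneration + EisensteinConjA (support WindowDichotomy). (why it might fail: Only if
mod-p^m reciprocity (CG Conj. A) fails for unit groups of quaternion orders; typed risks of gen 1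
re-checked benign by refuter a1bd204f-0 (one double coset ΓgΓ per tested v, d = χ_cyc);
centre-triviality = classes on the orbifold Γ̄\H³.) [CalegariGeraghty2017, Scholze2015,
CalegariVenkatesh2019, Calegari2023, Shimura1971]
#2 TorsionKudlaMillsonModularity (crux) — TKM, the card's headline conjecture, typed: with V' = {y :
σ-on-coordinates(y) = ȳ}, L = V' ∩ O, Γ¹ = norm-one units of O, δ ∈ K with σδ = −δ and a complex
embedding φ₀ of K (both only fix a global sign): for every finite commutative ring A and every
additive character c of Γ = O^× trivial on the centre, the c-TWISTED CLASS-NUMBER SERIES Θ(c) —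
whose coefficient at a totally positive T ∈ Sym₂(F) is the sum, over the (finitely many) Γ¹-orbits
of pairs x ∈ L² with Gram matrix ((x_i x̄_j).re) = T, of c(γ_x), γ_x the positively oriented
generator (modulo ±1) of the pointwise stabiliser of x in Γ¹ (= the holonomy of the closed geodesic
of Γ¹\H³ that is the Kudla–Millson cycle of x; orientation Pos = sign at σ₀ of
det[x₀,x₁,y,z]·δ·(⟨y,γz⟩−⟨y,γ⁻¹z⟩), a constant times a square, hence choice-free) — is, as a formal
q-series supported on totally positive T, an A-valued Hilbert–Siegel modular form of genus 2 over F: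
Θ(c) ∈ hilbertSiegelModularFormModN (Γ₀(𝔫)) (ψ∘det D) k A for some level 𝔫 ≠ 0, Dirichlet character
ψ mod 𝔫 and parallel weight k (intended k = 2 up to Hasse-invariant multiples and p-power level, ψ =
ε_{K/F}, odd at σ₀ as the orientation character requires; char 0 with ℤ-valued c: Kudla1981 /
KudlaMillson1990). Encoded relationally (IsTheta c f: f(T) = Σ_k c(γ_k) for every complete
irredundant system of orbit representatives and positive generators). [difficulty: open-problem]
(why it might fail: No integral/mod-N refinement of the Kudla–Millson Thom-form argument exists: for
genuinely torsion, non-congruence c the series may be modular only in Katz's sense beyond reductions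
of classical forms of any level, or only after multiplying by a neat-subgroup index (2-, 3-torsion
of Γ̄).) [KudlaMillson1990, doi:10.1007/bf01450546, HarrisSoudryTaylor1993, FaltingsChai1990,
Andrianov2009, Chevalley1951]
#3 ThetaInertAnnihilation (crux) — Torsion Hecke-equivariance in exact, level-free, testable form:
for every f with IsTheta c f (the coefficients of Θ(c) at totally positive T, uniquely determined)
and every principal prime (ϖ) of F with ϖ ≫ 0 that is INERT in K and prime to 2ab|A|, the genus-2
Hecke operator of the landed file kills Θ(c) up to the nebentypus sign: heckeT ϖ 2 e f T = 0 for all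
totally positive T and some e ∈ {1, −1} (expected e = ε_{K/F}(ϖ) = −1), i.e. Θ(c)(ϖT) + e·Σ_{D ∈
𝓓(ϖ)} Θ(c)(ϖ⁻¹DTDᵀ) + q_ϖ·Θ(c)(ϖ⁻¹T) = 0 — twisted class numbers of F-trace geodesics obey the
CM-type recursion at inert primes. Char 0 (ℤ-valued c): every constituent of the genus-2 theta lift
from GO(V') is automorphically induced from K (HarrisSoudryTaylor1993, Roberts2001), so Frob_ϖ has
trace 0 on Ind_K^F and T(ϖ) acts by 0; torsion: expected from the cycle-level Eichler commutation
relation (ϖ-neighbours of L; Yoshida1980 doi:10.1007/bf01390016, Andrianov2009 Ch. 5) and strong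
approximation for Spin(V'). [difficulty: L] (why it might fail: For torsion c the Eichler–Andrianov
neighbour relation for the (3,1)-lattice L must hold on geodesic holonomies INTEGRALLY; denominators
(stabiliser indices, local densities at ϖ, Weil-representation normalisation) would break it when
|A| meets those primes; one computation decides.) [doi:10.1007/bf01390016, Andrianov2009,
HarrisSoudryTaylor1993, Roberts2001, KudlaMillson1990]
#4 ThetaVisibleConjA (crux) — The engine's OUTPUT and the node the two theta cruxes decompose (gen-1
rank-2 crux, encoding checked by refuter a1bd204f-0, frame updated): the conclusion of X for
eigen-characters c that are THETA-VISIBLE, i.e. c(γ) ≠ 0 for some norm-one γ ∈ Γ of infinite order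
with reduced trace in F — exactly the holonomies of Kudla–Millson special geodesics (pointwise
stabilisers of totally positive F-rational 2-planes of V'). Reached through ThetaEngineCompletion
from cruxes 2 and 3; may also be attacked directly. [difficulty: XL] (why it might fail: Θ(c) with
ℤ/|A| coefficients may fail to be a mod-|A| Hilbert–Siegel form (no integral KM theory); theta
dichotomy for (O(V'), Sp₄) can put first occurrence in genus 3, killing the genus-2 lift of cuspidal
c; torsion pseudo-reps of weight-2 Hilbert–Siegel classes over F ≠ ℚ are unproved.)
[KudlaMillson1990, HarrisSoudryTaylor1993, Roberts2001, Taylor1991, Taylor1994,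
GoldringKoskivirta2019, BergerHarcos2007]
#5 ThetaEngineCompletion (crux) — THE ENGINE COMPLETION: TorsionKudlaMillsonModularity →
ThetaInertAnnihilation → ThetaVisibleConjA. Content: (i) the split-prime Hecke relation T(ϖ_v)Θ(c) =
Θ(T_w c) + Θ(T_{w^σ} c) for v = w·w^σ (cycle-level Eichler relation, the companion of crux 3); (ii)
NON-VANISHING of Θ(c) for theta-visible c (torsion analogue of the injectivity of the Kudla–Millson
lift, Bruinier–Funke / Kiefer–Zuffetti doi:10.1017/s0010437x2610308x in char 0; theta dichotomy for
(O(V'), Sp₄)); (iii) Galois pseudo-representations over F attached to mod-p^m Hecke eigensystems in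
hilbertSiegelModularFormModN of parallel weight (char 0 over ℚ: Taylor1991; torsion coherent
cohomology of Hodge-type Hilbert–Siegel varieties: arXiv:1507.05922, GoldringKoskivirta2019,
EmertonReduzziXiao2017-type); (iv) EXTRACTION of (t, d) over K from the 4-dimensional
pseudo-representation over F (R ≅ R ⊗ ε_{K/F}; HarrisSoudryTaylor1993 §3 twisting, Taylor1994,
BergerHarcos2007), with the T_w-eigenvalues read off through (i) and crux 3. The division hypothesis
excludes the Bianchi/matrix case, so Scholze2015 is no shortcut. [deps:
TorsionKudlaMillsonModularity, ThetaInertAnnihilation] [difficulty: XL] (why it might fail: Implied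
by ThetaVisibleConjA, so unrefutable as typed; as a PROOF: torsion pseudo-reps for weight-2
Hilbert–Siegel eigensystems over F ≠ ℚ are unproved, theta dichotomy may kill Θ(c) for cuspidal c
(first occurrence in genus 3), and twist-extraction needs TKM for twisted coefficients.)
[Taylor1991, arXiv:1507.05922, GoldringKoskivirta2019, EmertonReduzziXiao2017,
HarrisSoudryTaylor1993, Taylor1994, BergerHarcos2007, Roberts2001]
#6 FTraceCongruenceGeneration (crux) — NON-DEGENERACY of the torsion theta kernel (gen-1 crux,
refuter-checked encoding, frame updated): for some N ≥ 1 every norm-one unit of O congruent to 1 mod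
N·O lies in the subgroup generated by the theta-visible elements (norm-one units of infinite order
with reduced trace in F) and the commutators of Γ = O^×; equivalently every character of Γ that
kills the holonomy of every special geodesic is a congruence (Eisenstein) character. Repaired in gen
1 against the residual-torus obstruction at primes dividing a inert in K/F (hence the slack N and
the restriction to norm one). Rational content: Kudla–Millson classes span H₁(Γ¹\H³, ℚ) modulo
congruence homology (KM injectivity + HST/Roberts non-vanishing, modulo theta dichotomy) — not in
print as stated; torsion content new. The Bianchi version of gen 1 (FTraceGenerationBianchi) was
shown trivially true by unipotents (refuter 79b8ea41-0 evidence on stmt-Langlands-3121); Γ here is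
cocompact, has no parabolics, and that argument does not transfer. [difficulty: L] (why it might
fail: In the l₀ = 1 regime H₁-torsion grows exponentially (BergeronVenkatesh2012); nothing forces a
p-torsion character to see a special geodesic; even rationally, spanning H₁ modulo congruence
homology needs genus-2 theta non-vanishing for all cuspidal π (Roberts2001: tempered, up to twist).)
[BergeronVenkatesh2012, MarshallMuller2013, Roberts2001, HarrisSoudryTaylor1993, KudlaMillson1990,
BergeronMillsonMoeglin2016]
#9 EisensteinConjA (support) — EISENSTEIN / CONGRUENCE complement (gen-1 item, retriaged support):
the conclusion of X for eigen-characters c that vanish on a norm-one principal congruence subgroup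
Γ¹(N) = {u ∈ O^× : u ≡ 1 mod N·O, u ū = 1}. Such c factor through O^×/Γ¹(N) (an extension of a
finite congruence quotient by unit norms) and are Galois-Eisenstein: c = ψ∘nrd has T_v-eigenvalue
q_v + 1 and (t, d) = (1 + χ_cyc, χ_cyc) mod |A| works; in general t = χ₁ + χ₂ from class field
theory of K. Proof weight only (quadratic class field theory over K, ModNCyclotomicCharacter in the
tree), not truth. [difficulty: M] [CalegariVenkatesh2019, Chevalley1951, Shimura1971,
arXiv:1212.3847]
#9 WindowDichotomy (support) — The glue ThetaVisibleConjA → FTraceCongruenceGeneration →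
EisensteinConjA → ConjAWindowTheta: a centre-trivial eigen-character either sees an F-trace
loxodromic (ThetaVisibleConjA applies) or kills all of them; being additive on the subgroup O^×
('IsG is a subgroup': the coordinates of a product are O_K-bilinear in the coordinates since a, b ∈
O_F — c. 30 lines) it kills commutators, hence the closure in FTraceCongruenceGeneration, hence
Γ¹(N), and EisensteinConjA applies. Pure logic plus that lemma; term-mode skeleton in the planner's
Sketch.lean. [difficulty: provable-now] [VignerasLNM800, Shimura1971]
#9 BeyondTorsionWindow (support) — RESIDUAL, declared and NOT attacked by this route:
ConjAWindowTheta → Langlands — the rest of the summit given X. Inside the window for n = 2 its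
intended content is Calegari–Geraghty patching in defect l₀ = 1 (CalegariGeraghty2017: Conj. A with
local–global compatibility + Conj. B, automatic for compact 3-manifolds, ⟹ minimal modularity
lifting), fed by X upgraded to all unramified places and to p | level, Taylor's potential residual
automorphy for GL₂, characteristic-0 Jacquet–Langlands back to GL₂/K (direction (B) over the
window), and the ℓ-adic limit of X (Taylor1991 gluing) for direction (A), which in characteristic 0
is largely known for n = 2 (HarrisSoudryTaylor1993, BergerHarcos2007, Mok2014, BoxerEtAl2021);
everything else (other fields, n ≥ 3, compatibility at every place, de Rham) is untouched. Listed
only so that the deciding theorem is an honest implication whose mathematical content is exactly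
'cruxes ⟹ X'; a sector route on an all-fields/all-ranks summit cannot do better, and refuters should
grade the target and the cruxes (pattern of route-Langlands-QuadraticWindow, BeyondTheWindow).
[difficulty: open-problem] [CalegariGeraghty2017, BuzzardGeeLMS2014, Taylor1991,
HarrisSoudryTaylor1993]

TWO-LAYER PLAN. Foreseen glued splits (k ≤ 3, depth 1), filed only when a crux closes or stalls with
a census: ThetaEngineCompletion ⇐ SplitHeckeRelation
(T(ϖ_v)Θ(c) = Θ(T_w c) + Θ(T_{w^σ}c), typable today over heckeT and the HR operator) →
HilbertSiegelTorsionPseudoRep (4-dimensional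
pseudo-representations over F for eigensystems in hilbertSiegelModularFormModN, typable over
Literature…Pseudocharacter) → ExtractionOverK;
TorsionKudlaMillsonModularity ⇐ IntegralWeilLattice (a Γ × Γ₀(𝔫)-stable lattice in the Schrödinger
model over ℤ[1/2abD, ζ_N]) →
ThomFormIntegrality (the KM class is the image of an integral class) → TKM;
FTraceCongruenceGeneration ⇐ RationalSpan (KM-lift injectivity
for Γ¹, char 0) → TorsionSpan.

KILL CRITERIA. (i) ONE computation (K, a, b, c, ϖ, T) violating ThetaInertAnnihilation for both
signs e — a cocompact Kleinian presentation (Page's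
KleinianGroups / SnapPy arithmetic census), H₁-torsion character c, enumeration of F-trace
loxodromics and of Γ¹-orbits of admissible pairs
for the few smallest T — refutes crux 3 and the Hecke-equivariant engine: close
`refuted:ThetaInertAnnihilation` unless the failure is a
2- /3-torsion index artefact (then restate over a neat Γ'). (ii) A Θ(c) provably outside every
hilbertSiegelModularFormModN (Γ₀ 𝔫) (ψ∘det D) k A
refutes TKM and closes the route outright. (iii) A theta-blind cuspidal character (kills every
F-trace loxodromic, is not congruence) refutes
FTraceCongruenceGeneration: the route survives only as 'Conj. A for theta-visible c' — restate X
with the visibility hypothesis. (iv) X proved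
elsewhere (torsion Jacquet–Langlands + a boundary construction reaching the window) moots the route.
BeyondTorsionWindow is a declared residual.

NOT DECOMPOSED YET. The split-prime Hecke relation, torsion pseudo-representations for
Hilbert–Siegel eigensystems, the extraction over K and the non-vanishing
of Θ(c) (all inside ThetaEngineCompletion, layer 2 later); the exact level 𝔫, character ψ = ε_{K/F}
and weight k = 2 of TKM (left
existential on purpose: Katz-vs-classical mod-p forms in weight 2 and p-power level for
non-congruence c); rank ≤ 1 (singular T) terms of
the Kudla–Millson series (unconstrained by IsTheta); general central characters (HST's ω = χ∘N);
presentations (a, b) with B₀ non-split at σ₀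
(reached through (a, bD)); the Bianchi/matrix case (Scholze2015 at congruence level;
FunkeMillson2002-type boundary terms for non-compact X);
everything in the residual (CG patching, compatibility at p, n ≥ 3, other fields).

CHEAPEST FALSIFIER. ThetaInertAnnihilation on the smallest cocompact example with [F:ℚ] = 1 (then
'Hilbert–Siegel over ℚ' = classical genus-2 Siegel
q-expansions): K = ℚ(i) or ℚ(√−3), B = (a, b)_K a division algebra with a > 0, Γ¹ = O¹; compute a
presentation and H₁(Γ¹, ℤ), pick a
character c of prime order p ≥ 5 (p ∤ 2ab), enumerate rational-trace loxodromics by trace, identify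
the Γ¹-orbits of admissible pairs
with the three or four smallest Gram matrices T, and test Θ(c)(ϖT) + e Σ_D Θ(c)(ϖ⁻¹DTDᵀ) + q
Θ(c)(ϖ⁻¹T) = 0 for the smallest rational
prime ϖ inert in K (ϖ = 3 for ℚ(i)) and e = ±1. NOT run: kit offers gap/pari/python only (refuter
a1bd204f-0), the enumeration needs
Magma (KleinianGroups) or SnapPy — flagged for the operator; a python+SnapPy kit image would make it
a one-day job. The even cheaper
paper check — that Θ(c) has the built-in symmetry a(UTUᵀ) = sgn_{σ₀}(det U)·a(T), forcing ψ odd at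
σ₀, consistent with ψ = ε_{K/F} and
Chevalley1951 — was done by hand and passes.

NUMBERS. Weight (p+q)/2 = 2 and genus 2 for SO(3,1) (Kudla1981 doi:10.1007/bf01450546,
KudlaMillson1990); |Γ\ΓgΓ| = q_v + 1 at the tested v
(refuter a1bd204f-0 on stmt-Langlands-3118); Hecke recursion at weight 2: exponents k − 2 = 0, 2k −
3 = 1 (Andrianov2009 Prop. 5.16 as
transcribed in HilbertSiegel.heckeTWith_two_one_apply); expected sign e = ε_{K/F}(ϖ) = −1 at inert ϖ
≫ 0; items at open: 10 (1 target,
5 cruxes, 3 support, 1 assembly).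

DEFINITION REQUESTS. None new. Used:
Literature.NumberTheory.Automorphic.HilbertSiegelModularFormModN (landed today for gen 1's request
defn-HilbertSiegelModularFormModN;
fact-free, the route's only extra import). Not imported on purpose: QuaternionCoordOrder (coordOrder
/ unitGroup / normOneGroup /
congruenceSubgroup are literally the inline IsInt / IsG / G1 / Cong — provers rewrite with
mem_coordOrder_iff — but the file carries the named
fact coordOrder_heckeDoubleCoset, which would enter the cone). Wanted later (tenure): Katz-sense
mod-p Hilbert–Siegel forms of genus 2 (to pin
TKM's level/weight), the genus-2 theta dictionary at split primes, dimension-4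
pseudo-representations (Literature…Pseudocharacter exists).

Novelty: Searches (2026-08-15, this seat; plus the card's crossref/arXiv/zbMATH sweeps and refuter audits
aud-19/aud-20, all empty for torsion KM):
`lit search --hybrid "Kudla Millson special cycles generating series torsion coefficients mod p"`
(12 vector hits, none relevant beyond the
Kudla–Rapoport–Yang book); `lit search --source crossref "Kudla Millson geodesics hyperbolic
3-manifold Siegel modular"` (15: Kudla1981
doi:10.1007/bf01450546, FunkeMillson2002 doi:10.1007/s002290100241, KudlaMillson1979
doi:10.1007/bf01390229, LiMillson1993
doi:10.1215/s0012-7094-93-07115-3, Kiefer–Zuffetti doi:10.1017/s0010437x2610308x, Branchereau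
doi:10.1007/s00209-025-03683-0 — all complex
coefficients); `lit search --source arxiv "Kudla Millson lift torsion cohomology hyperbolic
manifolds"` (0); `lit search --source zbmath
"special cycles hyperbolic 3-manifolds generating series modular torsion"` (0); `lit galaxy search
"torsion classes Kudla-Millson" --star all`
(0), `"class number series of geodesics" --star all` (0), `"special cycles on hyperbolic
3-manifolds" --star all` (0), `"mod p Siegel modular
forms of weight 2" --star all` (0), `"Kudla-Millson theta lift" --star pdf` (2: Branchereau thesis,
Bruinier–Funke injectivity — char 0);
`lit frontier Langlands --since 2022` (30 rows; nearest: arXiv:2602.04778 R = T for orthogonal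
Shimura varieties — unrelated mechanism);
`lit bridges Langlands --cross any` (nothing on theta/cycles).
Nearest prior art found: Kudla1981 (doi:10.1007/bf01450546) and  [refs: 10.1007/bf01450546, 10.1007/s002290100241, 10.1007/bf01390229, 10.1215/s0012-7094-93-07115-3, 10.1017/s0010437x2610308x, 10.1007/s00209-025-03683-0, 10.1007/bf02699880, 10.1007/bf01232440, 10.1007/bf01390016, 2602.04778, doi:10.1007/bf01450546, doi:10.1007/s002290100241, doi:10.1007/bf01390229, doi:10.1215/s0012-7094-93-07115-3, doi:10.1017/s0010437x2610308x, doi:10.1007/s00209-025-03683-0, doi:10]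

Barriers (technique_class: torsion-theta kudla-millson special-cycles kleinian): - technique_class: torsion-theta kudla-millson special-cycles kleinian
- Literature.Barriers.Langlands.ShimuraVarietyRealizationBarrier: APPLIES to the window
(Res_{K/ℚ}GL₂ has l₀ = 1: no Shimura variety; U_{K/F}(2,2) is GL₄(ℝ) at the split place, so no
boundary trick) and is EVADED the only way it allows — nothing is realised over K: holonomies of
geodesics on the non-algebraic 3-orbifold are pushed by the theta kernel to q-expansions over the
totally real F, where Hilbert–Siegel varieties of Hodge type exist; the barrier's own invariant
chose the host (the split orthogonal host of the card keeps an equal-rank defect, the quaternionic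
inner form compactifies it away).
- Literature.Barriers.Langlands.NonRegularWeightBarrier: NOT ENGAGED — torsion characters carry no
archimedean weight; the target weight on GSp₄/F is parallel 2, a holomorphic limit of discrete
series handled mod p by Hasse invariants (the weight k of TKM is existential for exactly this
reason).
- Literature.Barriers.Langlands.TwistedEndoscopySelfDual: NOT MET — the transfer GO(V') → GSp₄ is a
theta correspondence realised by cycles, not a twisted trace formula; for n = 2 the symplectic
self-duality of Ind_K^F is automatic. Honest limit: n ≥ 3 would need unitary dual pairs (another
card).
- Literature.Barriers.Langlands.TaylorWilesNumericalCoincidence: enters only inside the residual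
BeyondTorsionWindow (CG patching in defect l₀ = 1 is exactly its positive-defect setting); not
evaded, not needed for the cruxes.

History (route lifecycle, newest last):
- 2026-08-16T02:19:16Z · AUTO-CRUX: 1 conjecture-grade item(s) promoted to crux (ConjAWindowTheta) — refuter vetting / tiering apply (operator:999:1362873)
- 2026-08-22T13:12:28Z · DORMANT — reconciler: no traction for 5.3 d (last activity item-evidence-added at 2026-08-17T04:09:56Z); parked, not closed — `ledger route dormant route-Langlands-Torsio (operator:999:4011244)
- 2026-08-31T16:01:10Z · REACTIVATED (open) — reconciler: reactivated — activity statement-closed at 2026-08-31T15:22:50Z after parking at 2026-08-22T13:12:28Z (operator:999:751935)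

sub-problem: Langlands · status: open · opened planner-plancard-Langlands-Langlands-torsion--be042e3d-g2-0 2026-08-15T19:20:59Z · rev 3 · ledger route-Langlands-TorsionKudlaMillsonWindow
GENERATED by the gate from the ledger (D-0016/17). Provers cite these decls: `theorem foo : Summit.Langlands.Langlands.Theses.TorsionKudlaMillsonWindow.<Decl> := …` in Summits/Langlands/Langlands/Theorems/<Name>.lean.
-/

namespace Summit.Langlands.Langlands.Theses.TorsionKudlaMillsonWindow

open scoped BigOperators Topology Manifold Classical MeasureTheory ProbabilityTheory Matrix InnerProductSpace ComplexConjugate ContinuousMap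
open Filter Set Function TopologicalSpace MeasureTheory

attribute [summit_statement] _root_.Langlands

/-- item stmt-Langlands-13528 · target · rank 0 · open · by planner
why it might fail: False only if mod-p^m reciprocity (CG Conj. A) fails for unit groups of quaternion orders over the window; untested in both regimes: [F:ℚ]=1 cocompact (torsion JL only numerical, CalegariVenkatesh2019), [F:ℚ]≥2 (no Shimura variety, Calegari2023 §10). Encoding (one ΓgΓ per v, d=χ_cyc) refuter-checked
sources: CalegariGeraghty2017, CalegariVenkatesh2019, Calegari2023, Scholze2015, Shimura1971, BergeronVenkatesh2012
[target] X as in § Thesis (Conjecture A at Satake level, degree 1, unit groups of coordinate orders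
of division quaternion algebras over the quadratic window, characters trivial on the centre).
Regimes: [F:ℚ] = 1 — compact arithmetic 3-manifolds over imaginary quadratic K, OPEN (no
Hecke-equivariant torsion Jacquet–Langlands); [F:ℚ] ≥ 2 — the window proper, OPEN (Calegari2023
§10). The matrix/Bianchi case of gen 1 is excluded by the division hypothesis (its calibration crux
was trivially true). Follows by logic from ThetaVisibleConjA + FTraceCongruenceGeneration +
EisensteinConjA (support WindowDichotomy). -/
@[route_item "route-Langlands-TorsionKudlaMillsonWindow"]
def ConjAWindowTheta : Prop :=
  ∀ (F K : Type) [Field F] [NumberField F] [Field K] [NumberField K] [Algebra F K] (σ : K ≃ₐ[F] K) (a b : NumberField.RingOfIntegers F), NumberField.IsTotallyReal F → Module.finrank F K = 2 → σ ≠ 1 → NumberField.InfinitePlace.nrComplexPlaces K = 1 → a ≠ 0 → b ≠ 0 → (∀ φ : K →+* ℂ, (starRingEnd ℂ).comp φ = φ → (φ (algebraMap F K a)).re < 0 ∧ (φ (algebraMap F K b)).re < 0) → (∀ φ : K →+* ℂ, (starRingEnd ℂ).comp φ ≠ φ → 0 < (φ (algebraMap F K a)).re ∨ 0 < (φ (algebraMap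 F K b)).re) → let a' : K := algebraMap F K a; let b' : K := algebraMap F K b; (∀ y : QuaternionAlgebra K a' 0 b', y * star y = 0 → y = 0) → let IsInt : QuaternionAlgebra K a' 0 b' → Prop := fun x => ∀ i : Fin 4, QuaternionAlgebra.equivTuple a' 0 b' x i ∈ Set.range (algebraMap (NumberField.RingOfIntegers K) K); let IsG : (QuaternionAlgebra K a' 0 b')ˣ → Prop := fun u => IsInt (u : QuaternionAlgebra K a' 0 b') ∧ IsInt ((u⁻¹ : (QuaternionAlgebra K a' 0 b')ˣ) : QuaternionAlgebra K a' 0 b'); ∀ (A : Type) [CommRing A] [Finite A], let HR : ((QuaternionAlgebra K a' 0 b')ˣ → A) → (QuaternionAlgebra K a' 0 b')ˣ → A → Prop := fun c g l => ∃ (k : ℕ) (r : Fin k → (QuaternionAlgebra K a' 0 b')ˣ), (∀ i, ∃ γ₁ γ₂, IsG γ₁ ∧ IsG γ₂ ∧ r i = γ₁ * g * γ₂) ∧ (∀ γ₁ γ₂, IsG γ₁ → IsG γ₂ → ∃! i, ∃ γ, IsG γ ∧ γ₁ * g * γ₂ = γ * r i) ∧ (∀ γ, IsG γ → ∀ (s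 : Fin k → Fin k) (e : Fin k → (QuaternionAlgebra K a' 0 b')ˣ), (∀ i, IsG (e i) ∧ r i * γ = e i * r (s i)) → ∑ i, c (e i) = l * c γ); let PR : (Field.absoluteGaloisGroup K → A) → (Field.absoluteGaloisGroup K → A) → Prop := fun t d => t 1 = 2 ∧ d 1 = 1 ∧ (∀ x y, d (x * y) = d x * d y) ∧ (∀ x y, t (x * y) = t (y * x)) ∧ (∀ x y, t x * t y = t (x * y) + d y * t (x * y⁻¹)) ∧ IsLocallyConstant t ∧ IsLocallyConstant d; ∀ (c : (QuaternionAlgebra K a' 0 b')ˣ → A), (∀ x y, IsG x → IsG y → c (x * y) = c x + c y) → (∀ u, IsG u → (u : QuaternionAlgebra K a' 0 b') ∈ Set.range (algebraMap K (QuaternionAlgebra K a' 0 b')) → c u = 0) → (∀ (ϖ : NumberField.RingOfIntegers K) (g : (QuaternionAlgebra K a' 0 b')ˣ) (v : IsDedekindDomain.HeightOneSpectrum (NumberField.RingOfIntegers K)), Prime ϖ → v.asIdeal = Ideal.span {ϖ} → IsInt (g : QuaternionAlgebra K a' 0 b') → (g : QuaternionAlgebra K a' 0 b') * star (g : QuaternionAlgebra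 K a' 0 b') = algebraMap K (QuaternionAlgebra K a' 0 b') (ϖ : K) → (2 * algebraMap (NumberField.RingOfIntegers F) (NumberField.RingOfIntegers K) (a * b) * (Nat.card A : NumberField.RingOfIntegers K)) ∉ v.asIdeal → ∃ l : A, HR c g l) → ∃ t d : Field.absoluteGaloisGroup K → A, PR t d ∧ ∀ (ϖ : NumberField.RingOfIntegers K) (g : (QuaternionAlgebra K a' 0 b')ˣ) (v : IsDedekindDomain.HeightOneSpectrum (NumberField.RingOfIntegers K)), Prime ϖ → v.asIdeal = Ideal.span {ϖ} → IsInt (g : QuaternionAlgebra K a' 0 b') → (g : QuaternionAlgebra K a' 0 b') * star (g : QuaternionAlgebra K a' 0 b') = algebraMap K (QuaternionAlgebra K a' 0 b') (ϖ : K) → (2 * algebraMap (NumberField.RingOfIntegers F) (NumberField.RingOfIntegers K) (a * b) * (Nat.card A : NumberField.RingOfIntegers K)) ∉ v.asIdeal → ∀ 𝔓 ∈ v.primesAbove, (∀ τ ∈ 𝔓.inertia (Field.absoluteGaloisGroup K), ∀ s, t (s * τ) = t s ∧ d (s * τ) = d s) ∧ ∀ s, IsArithFrobAt (NumberField.RingOfIntegers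 K) s 𝔓 → HR c g (t s) ∧ d s = (v.residueCard : A)

/-- item stmt-Langlands-13529 · crux · rank 2 · open · by planner
why it might fail: Known only in char 0 (Kudla1981, KudlaMillson1990: ℤ-valued c). For c pairing non-trivially with H₁(Γ¹,ℤ)_tors, Θ(c) reduces no Θ(c̃) and no integral/mod-N theta kernel exists; k, 𝔫, ψ being existential (Hasse weight-raising), failure = Θ(c) is not even a Katz form, or modular only over a neat Γ'.
sources: KudlaMillson1990, Kudla1981, FunkeMillson2002, FaltingsChai1990, Yoshida1980, HarrisSoudryTaylor1993
[crux] TKM, the card's headline conjecture, typed: with V' = {y : σ-on-coordinates(y) = ȳ}, L = V' ∩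
O, Γ¹ = norm-one units of O, δ ∈ K with σδ = −δ and a complex embedding φ₀ of K (both only fix a
global sign): for every finite commutative ring A and every additive character c of Γ = O^× trivial
on the centre, the c-TWISTED CLASS-NUMBER SERIES Θ(c) — whose coefficient at a totally positive T ∈
Sym₂(F) is the sum, over the (finitely many) Γ¹-orbits of pairs x ∈ L² with Gram matrix ((x_i
x̄_j).re) = T, of c(γ_x), γ_x the positively oriented generator (modulo ±1) of the pointwise
stabiliser of x in Γ¹ (= the holonomy of the closed geodesic of Γ¹\H³ that is the Kudla–Millson
cycle of x; orientation Pos = sign at σ₀ of det[x₀,x₁,y,z]·δ·(⟨y,γz⟩−⟨y,γ⁻¹z⟩), a constant times a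
square, hence choice-free) — is, as a formal q-series supported on totally positive T, an A-valued
Hilbert–Siegel modular form of genus 2 over F: Θ(c) ∈ hilbertSiegelModularFormModN (Γ₀(𝔫)) (ψ∘det D)
k A for some level 𝔫 ≠ 0, Dirichlet character ψ mod 𝔫 and parallel weight k (intended k = 2 up to
Hasse-invariant multiples and p-power level, ψ = ε_{K/F}, odd at σ₀ as the orientation character
requires; char 0 with ℤ-v -/
@[route_item "route-Langlands-TorsionKudlaMillsonWindow", crux]
def TorsionKudlaMillsonModularity : Prop :=
  ∀ (F K : Type) [Field F] [NumberField F] [Field K] [NumberField K] [Algebra F K] (σ : K ≃ₐ[F] K) (a b : NumberField.RingOfIntegers F), NumberField.IsTotallyReal F → Module.finrank F K = 2 → σ ≠ 1 → NumberField.InfinitePlace.nrComplexPlaces K = 1 → a ≠ 0 → b ≠ 0 → (∀ φ : K →+* ℂ, (starRingEnd ℂ).comp φ = φ → (φ (algebraMap F K a)).re < 0 ∧ (φ (algebraMap F K b)).re < 0) → (∀ φ : K →+* ℂ, (starRingEnd ℂ).comp φ ≠ φ → 0 < (φ (algebraMap F K a)).re ∨ 0 < (φ (algebraMap F K b)).re)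 → let a' : K := algebraMap F K a; let b' : K := algebraMap F K b; (∀ y : QuaternionAlgebra K a' 0 b', y * star y = 0 → y = 0) → let IsInt : QuaternionAlgebra K a' 0 b' → Prop := fun x => ∀ i : Fin 4, QuaternionAlgebra.equivTuple a' 0 b' x i ∈ Set.range (algebraMap (NumberField.RingOfIntegers K) K); let IsG : (QuaternionAlgebra K a' 0 b')ˣ → Prop := fun u => IsInt (u : QuaternionAlgebra K a' 0 b') ∧ IsInt ((u⁻¹ : (QuaternionAlgebra K a' 0 b')ˣ) : QuaternionAlgebra K a' 0 b'); ∀ (δ : K) (φ₀ : K →+* ℂ), σ δ = -δ → δ ≠ 0 → (starRingEnd ℂ).comp φ₀ ≠ φ₀ → let sB : QuaternionAlgebra K a' 0 b' → QuaternionAlgebra K a' 0 b' := fun y => ⟨σ y.re, σ y.imI, σ y.imJ, σ y.imK⟩; let V : QuaternionAlgebra K a' 0 b' → Prop := fun y => sB y = star y; let ip : QuaternionAlgebra K a' 0 b' → QuaternionAlgebra K a' 0 b' → K := fun y z => (y * star z).re; let act : QuaternionAlgebra K a' 0 b' → QuaternionAlgebra K a' 0 b' → QuaternionAlgebra K a'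 0 b' := fun g y => g * y * sB (star g); let G1 : (QuaternionAlgebra K a' 0 b')ˣ → Prop := fun u => IsG u ∧ (u : QuaternionAlgebra K a' 0 b') * star (u : QuaternionAlgebra K a' 0 b') = 1; let Stab : (Fin 2 → QuaternionAlgebra K a' 0 b') → (QuaternionAlgebra K a' 0 b')ˣ → Prop := fun x γ => G1 γ ∧ ∀ i, act γ (x i) = x i; let Pos : (Fin 2 → QuaternionAlgebra K a' 0 b') → (QuaternionAlgebra K a' 0 b')ˣ → Prop := fun x γ => ∃ y z, V y ∧ V z ∧ 0 < (φ₀ ((Matrix.of ![QuaternionAlgebra.equivTuple a' 0 b' (x 0), QuaternionAlgebra.equivTuple a' 0 b' (x 1), QuaternionAlgebra.equivTuple a' 0 b' y, QuaternionAlgebra.equivTuple a' 0 b' z]).det * δ * (ip y (act γ z) - ip y (act ((γ⁻¹ : (QuaternionAlgebra K a' 0 b')ˣ) : QuaternionAlgebra K a' 0 b') z)))).re; let Gen : (Fin 2 → QuaternionAlgebra K a' 0 b') → (QuaternionAlgebra K a' 0 b')ˣ → Prop := fun x γ => Stab x γ ∧ Pos x γ ∧ ∀ γ', Stab x γ' →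 ∃ (n : ℤ) (ζ : (QuaternionAlgebra K a' 0 b')ˣ), IsOfFinOrder ζ ∧ γ' = ζ * γ ^ n; let Adm : Matrix (Fin 2) (Fin 2) F → (Fin 2 → QuaternionAlgebra K a' 0 b') → Prop := fun T x => (∀ i, V (x i) ∧ IsInt (x i)) ∧ ∀ i j, ip (x i) (x j) = algebraMap F K (T i j); ∀ (A : Type) [CommRing A] [Finite A], let IsTheta : ((QuaternionAlgebra K a' 0 b')ˣ → A) → (Matrix (Fin 2) (Fin 2) F → A) → Prop := fun c f => ∀ T : Matrix (Fin 2) (Fin 2) F, (∀ τ : F →+* ℝ, (T.map τ).PosDef) → ∀ (m : ℕ) (x : Fin m → Fin 2 → QuaternionAlgebra K a' 0 b'), (∀ k, Adm T (x k)) → (∀ x', Adm T x' → ∃! k, ∃ g, G1 g ∧ ∀ i, act g (x' i) = x k i) → ∀ γ : Fin m → (QuaternionAlgebra K a' 0 b')ˣ, (∀ k, Gen (x k) (γ k)) → f T = ∑ k, c (γ k); ∀ (c : (QuaternionAlgebra K a' 0 b')ˣ → A), (∀ x y, IsG x → IsG y → c (x * y) = c x + c y) → (∀ u, IsG u → (u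 : QuaternionAlgebra K a' 0 b') ∈ Set.range (algebraMap K (QuaternionAlgebra K a' 0 b')) → c u = 0) → ∃ (𝔫 : Ideal (NumberField.RingOfIntegers F)) (ψ : MulChar (NumberField.RingOfIntegers F ⧸ 𝔫) ℂ) (k : ℕ) (f : Matrix (Fin 2) (Fin 2) F → A), 𝔫 ≠ ⊥ ∧ f ∈ Literature.NumberTheory.Automorphic.hilbertSiegelModularFormModN (Literature.NumberTheory.Automorphic.HilbertSiegel.Gamma0 𝔫) (Literature.NumberTheory.Automorphic.HilbertSiegel.Gamma0.character 𝔫 ψ) k A ∧ IsTheta c f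

/-- item stmt-Langlands-18921 · crux · rank 2 · open · by planner
why it might fail: The spinor-exceptional square classes of the lattices gO₀∩B₀⁰ must be finite uniformly in γ though the genus varies with γ (Cartan exponents at good primes); a sporadic Brauer–Manin obstruction off C·F² (Colliot-Thélène–Xu) or a dyadic condition not constant on xΓ¹(M) refutes it.
sources: Kneser1956, Kneser1961, Hsia1976, SchulzePillot1980, ColliotTheleneXu2009, Borel1960
[crux] COSET TWIST — the representation half of the F-trace mechanism for FTraceCongruenceGeneration
(refuter evidence EVIDENCE.md §6 on stmt-Langlands-13533, now typed): for every finite T ⊂ K there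
are finitely many square classes C ⊂ F, a level M ≥ 1 and a base point x ∈ Γ¹ = O¹ such that every γ
∈ Γ¹ with γ ≡ x (mod M·O) whose σ-odd part y = γ − σ_B(γ) has nrd(y) ∉ C·F² admits u ∈ O₀¹ (norm-one
unit of O with coordinates in F) with γu of reduced trace in F (⇔ tr(g u) = 0 for g = y/(2δ) ∈ B₀ ⇔
nrd(g) is represented by the ternary O_F-lattice gO₀ ∩ B₀⁰, indefinite at σ₀) and re(u), re(γu) ∉ T.
Intended proof: x an F-trace element of Γ¹ outside B₀ (u = 1 solves the local problem at every
prime), M a high power of the primes over 2ab (local stability along the coset), representability by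
the genus (Cartan decomposition at good primes), no spinor exceptions off finitely many square
classes C since the good-prime local lattices ϖ^r(H ⊥ ⟨−ϖ^s⟩) have unit spinor norms (Kneser1956,
Kneser1961, Hsia1976, SchulzePillot1980; Brauer–Manin form ColliotTheleneXu2009), spinor genus =
class for indefinite ternary lattices, then Zariski density of (O₀ ∩ gO₀g⁻¹)¹ in B₀¹ (Borel1960) to
push re(u), -/
@[route_item "route-Langlands-TorsionKudlaMillsonWindow"]
def CosetFTraceTwist : Prop :=
  ∀ (F K : Type) [Field F] [NumberField F] [Field K] [NumberField K] [Algebra F K] (σ : K ≃ₐ[F] K) (a b : NumberField.RingOfIntegers F), NumberField.IsTotallyReal F → Module.finrank F K = 2 → σ ≠ 1 → NumberField.InfinitePlace.nrComplexPlaces K = 1 → a ≠ 0 → b ≠ 0 → (∀ φ : K →+* ℂ, (starRingEnd ℂ).comp φ = φ → (φ (algebraMap F K a)).re < 0 ∧ (φ (algebraMap F K b)).re < 0) → (∀ φ : K →+* ℂ, (starRingEnd ℂ).comp φ ≠ φ → 0 < (φ (algebraMap F K a)).re ∨ 0 < (φ (algebraMap F K b)).re) → let a' : K := algebraMap F K a;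 let b' : K := algebraMap F K b; (∀ y : QuaternionAlgebra K a' 0 b', y * star y = 0 → y = 0) → let IsInt : QuaternionAlgebra K a' 0 b' → Prop := fun x => ∀ i : Fin 4, QuaternionAlgebra.equivTuple a' 0 b' x i ∈ Set.range (algebraMap (NumberField.RingOfIntegers K) K); let IsG : (QuaternionAlgebra K a' 0 b')ˣ → Prop := fun u => IsInt (u : QuaternionAlgebra K a' 0 b') ∧ IsInt ((u⁻¹ : (QuaternionAlgebra K a' 0 b')ˣ) : QuaternionAlgebra K a' 0 b'); let G1 : (QuaternionAlgebra K a' 0 b')ˣ → Prop := fun u => IsG u ∧ (u : QuaternionAlgebra K a' 0 b') * star (u : QuaternionAlgebra K a' 0 b') = 1; let sB : QuaternionAlgebra K a' 0 b' → QuaternionAlgebra K a' 0 b' := fun y => ⟨σ y.re, σ y.imI, σ y.imJ, σ y.imK⟩; let Good : ℕ → (QuaternionAlgebra K a' 0 b')ˣ → Finset F → (QuaternionAlgebra K a' 0 b')ˣ → Prop := fun M x C γ => G1 γ ∧ (∀ i : Fin 4, QuaternionAlgebra.equivTuple a' 0 b' ((γ : QuaternionAlgebra K a' 0 b') - (x :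 QuaternionAlgebra K a' 0 b')) i ∈ Set.range (fun y : NumberField.RingOfIntegers K => (((M : NumberField.RingOfIntegers K) * y : NumberField.RingOfIntegers K) : K))) ∧ ∀ c ∈ C, ∀ f : F, (((γ : QuaternionAlgebra K a' 0 b') - sB (γ : QuaternionAlgebra K a' 0 b')) * star ((γ : QuaternionAlgebra K a' 0 b') - sB (γ : QuaternionAlgebra K a' 0 b'))).re ≠ algebraMap F K (c * f ^ 2); ∀ T : Finset K, ∃ (C : Finset F) (M : ℕ) (x : (QuaternionAlgebra K a' 0 b')ˣ), 0 < M ∧ G1 x ∧ ∀ γ, Good M x C γ → ∃ u : (QuaternionAlgebra K a' 0 b')ˣ, G1 u ∧ (∀ i : Fin 4, σ (QuaternionAlgebra.equivTuple a' 0 b' (u : QuaternionAlgebra K a' 0 b') i) = QuaternionAlgebra.equivTuple a' 0 b' (u : QuaternionAlgebra K a' 0 b') i) ∧ σ ((γ * u : (QuaternionAlgebra K a' 0 b')ˣ) : QuaternionAlgebra K a' 0 b').re = ((γ * u : (QuaternionAlgebra K a' 0 b')ˣ) : QuaternionAlgebra K a' 0 b').re ∧ (u : QuaternionAlgebra K a'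 0 b').re ∉ T ∧ ((γ * u : (QuaternionAlgebra K a' 0 b')ˣ) : QuaternionAlgebra K a' 0 b').re ∉ T

/-- item stmt-Langlands-13530 · crux · rank 3 · open · by planner
why it might fail: As typed it covers inert ϖ | 𝔡_F (only ϖ∤2ab|A| excluded): there qIndexSet has non-ϖ-integral T, ϖ is a level prime of Θ(c) for Γ₀⊂Sp₄(𝓞F), and heckeT f (G/ϖ) = Θ(c)(G) for all G of type ⟨1⟩⊥⟨ϖ⟩, generically ≠0 (F=ℚ(√5), ϖ=(5+√5)/2). For ϖ∤2ab𝔡_F it HOLDS with e=−1: L/ϖL ≅ O⁻₄(𝔽_q), Witt index 1.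
sources: Andrianov2009, Yoshida1980, KudlaMillson1990, Freitag1990, HarrisSoudryTaylor1993, Roberts2001
[crux] Torsion Hecke-equivariance in exact, level-free, testable form: for every f with IsTheta c f
(the coefficients of Θ(c) at totally positive T, uniquely determined) and every principal prime (ϖ)
of F with ϖ ≫ 0 that is INERT in K and prime to 2ab|A|, the genus-2 Hecke operator of the landed
file kills Θ(c) up to the nebentypus sign: heckeT ϖ 2 e f T = 0 for all totally positive T and some
e ∈ {1, −1} (expected e = ε_{K/F}(ϖ) = −1), i.e. Θ(c)(ϖT) + e·Σ_{D ∈ 𝓓(ϖ)} Θ(c)(ϖ⁻¹DTDᵀ) +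
q_ϖ·Θ(c)(ϖ⁻¹T) = 0 — twisted class numbers of F-trace geodesics obey the CM-type recursion at inert
primes. Char 0 (ℤ-valued c): every constituent of the genus-2 theta lift from GO(V') is
automorphically induced from K (HarrisSoudryTaylor1993, Roberts2001), so Frob_ϖ has trace 0 on
Ind_K^F and T(ϖ) acts by 0; torsion: expected from the cycle-level Eichler commutation relation
(ϖ-neighbours of L; Yoshida1980 doi:10.1007/bf01390016, Andrianov2009 Ch. 5) and strong
approximation for Spin(V'). [difficulty: L] -/
@[route_item "route-Langlands-TorsionKudlaMillsonWindow", crux]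
def ThetaInertAnnihilation : Prop :=
  ∀ (F K : Type) [Field F] [NumberField F] [Field K] [NumberField K] [Algebra F K] (σ : K ≃ₐ[F] K) (a b : NumberField.RingOfIntegers F), NumberField.IsTotallyReal F → Module.finrank F K = 2 → σ ≠ 1 → NumberField.InfinitePlace.nrComplexPlaces K = 1 → a ≠ 0 → b ≠ 0 → (∀ φ : K →+* ℂ, (starRingEnd ℂ).comp φ = φ → (φ (algebraMap F K a)).re < 0 ∧ (φ (algebraMap F K b)).re < 0) → (∀ φ : K →+* ℂ, (starRingEnd ℂ).comp φ ≠ φ → 0 < (φ (algebraMap F K a)).re ∨ 0 < (φ (algebraMap F K b)).re) → let a' : K := algebraMap F K a; let b' : K := algebraMap F K b; (∀ y : QuaternionAlgebra K a' 0 b', y * star y = 0 → y = 0) → let IsInt : QuaternionAlgebra K a' 0 b' → Prop := fun x => ∀ i : Fin 4, QuaternionAlgebra.equivTuple a' 0 b' x i ∈ Set.range (algebraMap (NumberField.RingOfIntegers K) K); let IsG : (QuaternionAlgebra K a' 0 b')ˣ → Prop := fun u => IsInt (u : QuaternionAlgebra K a' 0 b') ∧ IsInt ((u⁻¹ : (QuaternionAlgebra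 K a' 0 b')ˣ) : QuaternionAlgebra K a' 0 b'); ∀ (δ : K) (φ₀ : K →+* ℂ), σ δ = -δ → δ ≠ 0 → (starRingEnd ℂ).comp φ₀ ≠ φ₀ → let sB : QuaternionAlgebra K a' 0 b' → QuaternionAlgebra K a' 0 b' := fun y => ⟨σ y.re, σ y.imI, σ y.imJ, σ y.imK⟩; let V : QuaternionAlgebra K a' 0 b' → Prop := fun y => sB y = star y; let ip : QuaternionAlgebra K a' 0 b' → QuaternionAlgebra K a' 0 b' → K := fun y z => (y * star z).re; let act : QuaternionAlgebra K a' 0 b' → QuaternionAlgebra K a' 0 b' → QuaternionAlgebra K a' 0 b' := fun g y => g * y * sB (star g); let G1 : (QuaternionAlgebra K a' 0 b')ˣ → Prop := fun u => IsG u ∧ (u : QuaternionAlgebra K a' 0 b') * star (u : QuaternionAlgebra K a' 0 b') = 1; let Stab : (Fin 2 → QuaternionAlgebra K a' 0 b') → (QuaternionAlgebra K a' 0 b')ˣ → Prop := fun x γ => G1 γ ∧ ∀ i, act γ (x i) = x i; let Pos : (Fin 2 → QuaternionAlgebra K a' 0 b') → (QuaternionAlgebra K a' 0 b')ˣ → Prop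 := fun x γ => ∃ y z, V y ∧ V z ∧ 0 < (φ₀ ((Matrix.of ![QuaternionAlgebra.equivTuple a' 0 b' (x 0), QuaternionAlgebra.equivTuple a' 0 b' (x 1), QuaternionAlgebra.equivTuple a' 0 b' y, QuaternionAlgebra.equivTuple a' 0 b' z]).det * δ * (ip y (act γ z) - ip y (act ((γ⁻¹ : (QuaternionAlgebra K a' 0 b')ˣ) : QuaternionAlgebra K a' 0 b') z)))).re; let Gen : (Fin 2 → QuaternionAlgebra K a' 0 b') → (QuaternionAlgebra K a' 0 b')ˣ → Prop := fun x γ => Stab x γ ∧ Pos x γ ∧ ∀ γ', Stab x γ' → ∃ (n : ℤ) (ζ : (QuaternionAlgebra K a' 0 b')ˣ), IsOfFinOrder ζ ∧ γ' = ζ * γ ^ n; let Adm : Matrix (Fin 2) (Fin 2) F → (Fin 2 → QuaternionAlgebra K a' 0 b') → Prop := fun T x => (∀ i, V (x i) ∧ IsInt (x i)) ∧ ∀ i j, ip (x i) (x j) = algebraMap F K (T i j); ∀ (A : Type) [CommRing A] [Finite A], let IsTheta : ((QuaternionAlgebra K a' 0 b')ˣ → A) → (Matrix (Fin 2) (Fin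 2) F → A) → Prop := fun c f => ∀ T : Matrix (Fin 2) (Fin 2) F, (∀ τ : F →+* ℝ, (T.map τ).PosDef) → ∀ (m : ℕ) (x : Fin m → Fin 2 → QuaternionAlgebra K a' 0 b'), (∀ k, Adm T (x k)) → (∀ x', Adm T x' → ∃! k, ∃ g, G1 g ∧ ∀ i, act g (x' i) = x k i) → ∀ γ : Fin m → (QuaternionAlgebra K a' 0 b')ˣ, (∀ k, Gen (x k) (γ k)) → f T = ∑ k, c (γ k); ∀ (c : (QuaternionAlgebra K a' 0 b')ˣ → A), (∀ x y, IsG x → IsG y → c (x * y) = c x + c y) → (∀ u, IsG u → (u : QuaternionAlgebra K a' 0 b') ∈ Set.range (algebraMap K (QuaternionAlgebra K a' 0 b')) → c u = 0) → ∀ f : Matrix (Fin 2) (Fin 2) F → A, IsTheta c f → ∀ ϖ : NumberField.RingOfIntegers F, Prime ϖ → (∀ τ : F →+* ℝ, 0 < τ ϖ) → Prime (algebraMap (NumberField.RingOfIntegers F) (NumberField.RingOfIntegers K) ϖ) → (2 * a * b * (Nat.card A : NumberField.RingOfIntegers F)) ∉ Ideal.span {ϖ} → ∃ e : ℤ, (e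 = 1 ∨ e = -1) ∧ ∀ T : Matrix (Fin 2) (Fin 2) F, (∀ τ : F →+* ℝ, (T.map τ).PosDef) → Literature.NumberTheory.Automorphic.HilbertSiegel.heckeT ϖ 2 (e : A) f T = 0

/-- item stmt-Langlands-18923 · crux · rank 3 · open · by planner
why it might fail: M, x, C are universal: fails if on some coset xΓ¹(M) the values nrd(t−σ_B t) lie in finitely many square classes (a finite C empties Good), or if no prime makes every c∈C a square while nrd(t−σ_B t) takes a non-square unit value on (O/𝔭O)¹.
sources: Kneser1965, VignerasLNM800, PlatonovRapinchuk1994, Borel1960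
[crux] CONGRUENCE COSET CAPTURE (non-thinness of congruence subgroups of the cocompact Kleinian
group Γ¹): for every level M ≥ 1, base point x ∈ Γ¹ and finite C ⊂ F there is M' ≥ 1 with Γ¹(M') ⊆
Good⁻¹·Good, Good = {t ∈ Γ¹ : t ≡ x mod M·O, nrd(t − σ_B t) ∉ C·F²}: every norm-one γ ≡ 1 (mod M'·O)
is t₁⁻¹t₂ with t₁, t₂ ∈ Good. Intended proof: a prime 𝔭 ∤ 2abM of F modulo which every c ∈ C∖0 is a
non-zero square (Chebotarev in F(√C)/F), a residue t̄ ∈ (O/𝔭O)¹ on which nrd(t − σ_B t) is a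
non-square unit (explicit 2×2 count in the split and inert cases), a lift t ∈ xΓ¹(M) of t̄ by strong
approximation for B¹, split at the complex place (Kneser1965; VignerasLNM800 III Thm 4.3;
PlatonovRapinchuk1994 Thm 7.12), and M' = M·p, t₁ = t, t₂ = tγ. -/
@[route_item "route-Langlands-TorsionKudlaMillsonWindow"]
def CongruenceCosetCapture : Prop :=
  ∀ (F K : Type) [Field F] [NumberField F] [Field K] [NumberField K] [Algebra F K] (σ : K ≃ₐ[F] K) (a b : NumberField.RingOfIntegers F), NumberField.IsTotallyReal F → Module.finrank F K = 2 → σ ≠ 1 → NumberField.InfinitePlace.nrComplexPlaces K = 1 → a ≠ 0 → b ≠ 0 → (∀ φ : K →+* ℂ, (starRingEnd ℂ).comp φ = φ → (φ (algebraMap F K a)).re < 0 ∧ (φ (algebraMap F K b)).re < 0) → (∀ φ : K →+* ℂ, (starRingEnd ℂ).comp φ ≠ φ → 0 < (φ (algebraMap F K a)).re ∨ 0 < (φ (algebraMap F K b)).re) → let a' : K := algebraMap F K a; let b' : K := algebraMap F K b; (∀ y : QuaternionAlgebra K a' 0 b', y * star y = 0 → y = 0) → let IsInt : QuaternionAlgebra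 K a' 0 b' → Prop := fun x => ∀ i : Fin 4, QuaternionAlgebra.equivTuple a' 0 b' x i ∈ Set.range (algebraMap (NumberField.RingOfIntegers K) K); let IsG : (QuaternionAlgebra K a' 0 b')ˣ → Prop := fun u => IsInt (u : QuaternionAlgebra K a' 0 b') ∧ IsInt ((u⁻¹ : (QuaternionAlgebra K a' 0 b')ˣ) : QuaternionAlgebra K a' 0 b'); let Cong : ℕ → (QuaternionAlgebra K a' 0 b')ˣ → Prop := fun N u => IsG u ∧ ∀ i : Fin 4, QuaternionAlgebra.equivTuple a' 0 b' ((u : QuaternionAlgebra K a' 0 b') - 1) i ∈ Set.range (fun y : NumberField.RingOfIntegers K => (((N : NumberField.RingOfIntegers K) * y : NumberField.RingOfIntegers K) : K)); let G1 : (QuaternionAlgebra K a' 0 b')ˣ → Prop := fun u => IsG u ∧ (u : QuaternionAlgebra K a' 0 b') * star (u : QuaternionAlgebra K a' 0 b') = 1; let sB : QuaternionAlgebra K a' 0 b' → QuaternionAlgebra K a' 0 b' := fun y => ⟨σ y.re, σ y.imI, σ y.imJ, σ y.imK⟩; let Good : ℕ → (QuaternionAlgebra K a' 0 b')ˣ →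 Finset F → (QuaternionAlgebra K a' 0 b')ˣ → Prop := fun M x C γ => G1 γ ∧ (∀ i : Fin 4, QuaternionAlgebra.equivTuple a' 0 b' ((γ : QuaternionAlgebra K a' 0 b') - (x : QuaternionAlgebra K a' 0 b')) i ∈ Set.range (fun y : NumberField.RingOfIntegers K => (((M : NumberField.RingOfIntegers K) * y : NumberField.RingOfIntegers K) : K))) ∧ ∀ c ∈ C, ∀ f : F, (((γ : QuaternionAlgebra K a' 0 b') - sB (γ : QuaternionAlgebra K a' 0 b')) * star ((γ : QuaternionAlgebra K a' 0 b') - sB (γ : QuaternionAlgebra K a' 0 b'))).re ≠ algebraMap F K (c * f ^ 2); ∀ (M : ℕ) (x : (QuaternionAlgebra K a' 0 b')ˣ) (C : Finset F), 0 < M → G1 x → ∃ M' : ℕ, 0 < M' ∧ ∀ γ, Cong M' γ → (γ : QuaternionAlgebra K a' 0 b') * star (γ : QuaternionAlgebra K a' 0 b') = 1 → ∃ t₁ t₂ : (QuaternionAlgebra K a' 0 b')ˣ, Good M x C t₁ ∧ Good M x C t₂ ∧ γ = t₁⁻¹ * t₂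

/-- item stmt-Langlands-13531 · crux · rank 4 · open · by planner
why it might fail: Instance of CG Conj. A for cocompact Kleinian unit groups, restricted to theta-visible c: false only if torsion reciprocity fails there — a regime of exponential H₁-torsion (BergeronVenkatesh2012) with no Galois data checked (computations are Bianchi); inherits TKM and theta-dichotomy risk.
sources: CalegariVenkatesh2019, BergeronVenkatesh2012, Sengun2014Bianchi, KudlaMillson1990, HarrisSoudryTaylor1993, Roberts2001
[crux] The engine's OUTPUT and the node the two theta cruxes decompose (gen-1 rank-2 crux, encoding
checked by refuter a1bd204f-0, frame updated): the conclusion of X for eigen-characters c that are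
THETA-VISIBLE, i.e. c(γ) ≠ 0 for some norm-one γ ∈ Γ of infinite order with reduced trace in F —
exactly the holonomies of Kudla–Millson special geodesics (pointwise stabilisers of totally positive
F-rational 2-planes of V'). Reached through ThetaEngineCompletion from cruxes 2 and 3; may also be
attacked directly. [difficulty: XL] -/
@[route_item "route-Langlands-TorsionKudlaMillsonWindow"]
def ThetaVisibleConjA : Prop :=
  ∀ (F K : Type) [Field F] [NumberField F] [Field K] [NumberField K] [Algebra F K] (σ : K ≃ₐ[F] K) (a b : NumberField.RingOfIntegers F), NumberField.IsTotallyReal F → Module.finrank F K = 2 → σ ≠ 1 → NumberField.InfinitePlace.nrComplexPlaces K = 1 → a ≠ 0 → b ≠ 0 → (∀ φ : K →+* ℂ, (starRingEnd ℂ).comp φ = φ → (φ (algebraMap F K a)).re < 0 ∧ (φ (algebraMap F K b)).re < 0) → (∀ φ : K →+* ℂ, (starRingEnd ℂ).comp φ ≠ φ → 0 < (φ (algebraMap F K a)).re ∨ 0 < (φ (algebraMap F K b)).re) → let a' : K := algebraMap F K a; let b' : K := algebraMap F K b; (∀ y : QuaternionAlgebra K a' 0 b', y * star y = 0 → y = 0)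 → let IsInt : QuaternionAlgebra K a' 0 b' → Prop := fun x => ∀ i : Fin 4, QuaternionAlgebra.equivTuple a' 0 b' x i ∈ Set.range (algebraMap (NumberField.RingOfIntegers K) K); let IsG : (QuaternionAlgebra K a' 0 b')ˣ → Prop := fun u => IsInt (u : QuaternionAlgebra K a' 0 b') ∧ IsInt ((u⁻¹ : (QuaternionAlgebra K a' 0 b')ˣ) : QuaternionAlgebra K a' 0 b'); let FTr : (QuaternionAlgebra K a' 0 b')ˣ → Prop := fun u => IsG u ∧ (u : QuaternionAlgebra K a' 0 b') * star (u : QuaternionAlgebra K a' 0 b') = 1 ∧ σ (u : QuaternionAlgebra K a' 0 b').re = (u : QuaternionAlgebra K a' 0 b').re ∧ ¬ IsOfFinOrder u; ∀ (A : Type) [CommRing A] [Finite A], let HR : ((QuaternionAlgebra K a' 0 b')ˣ → A) → (QuaternionAlgebra K a' 0 b')ˣ → A → Prop := fun c g l => ∃ (k : ℕ) (r : Fin k → (QuaternionAlgebra K a' 0 b')ˣ), (∀ i, ∃ γ₁ γ₂, IsG γ₁ ∧ IsG γ₂ ∧ r i = γ₁ * g * γ₂) ∧ (∀ γ₁ γ₂,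 IsG γ₁ → IsG γ₂ → ∃! i, ∃ γ, IsG γ ∧ γ₁ * g * γ₂ = γ * r i) ∧ (∀ γ, IsG γ → ∀ (s : Fin k → Fin k) (e : Fin k → (QuaternionAlgebra K a' 0 b')ˣ), (∀ i, IsG (e i) ∧ r i * γ = e i * r (s i)) → ∑ i, c (e i) = l * c γ); let PR : (Field.absoluteGaloisGroup K → A) → (Field.absoluteGaloisGroup K → A) → Prop := fun t d => t 1 = 2 ∧ d 1 = 1 ∧ (∀ x y, d (x * y) = d x * d y) ∧ (∀ x y, t (x * y) = t (y * x)) ∧ (∀ x y, t x * t y = t (x * y) + d y * t (x * y⁻¹)) ∧ IsLocallyConstant t ∧ IsLocallyConstant d; ∀ (c : (QuaternionAlgebra K a' 0 b')ˣ → A), (∀ x y, IsG x → IsG y → c (x * y) = c x + c y) → (∀ u, IsG u → (u : QuaternionAlgebra K a' 0 b') ∈ Set.range (algebraMap K (QuaternionAlgebra K a' 0 b')) → c u = 0) → (∃ γ, FTr γ ∧ c γ ≠ 0) → (∀ (ϖ : NumberField.RingOfIntegers K) (g : (QuaternionAlgebra K a' 0 b')ˣ) (v : IsDedekindDomain.HeightOneSpectrum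 (NumberField.RingOfIntegers K)), Prime ϖ → v.asIdeal = Ideal.span {ϖ} → IsInt (g : QuaternionAlgebra K a' 0 b') → (g : QuaternionAlgebra K a' 0 b') * star (g : QuaternionAlgebra K a' 0 b') = algebraMap K (QuaternionAlgebra K a' 0 b') (ϖ : K) → (2 * algebraMap (NumberField.RingOfIntegers F) (NumberField.RingOfIntegers K) (a * b) * (Nat.card A : NumberField.RingOfIntegers K)) ∉ v.asIdeal → ∃ l : A, HR c g l) → ∃ t d : Field.absoluteGaloisGroup K → A, PR t d ∧ ∀ (ϖ : NumberField.RingOfIntegers K) (g : (QuaternionAlgebra K a' 0 b')ˣ) (v : IsDedekindDomain.HeightOneSpectrum (NumberField.RingOfIntegers K)), Prime ϖ → v.asIdeal = Ideal.span {ϖ} → IsInt (g : QuaternionAlgebra K a' 0 b') → (g : QuaternionAlgebra K a' 0 b') * star (g : QuaternionAlgebra K a' 0 b') = algebraMap K (QuaternionAlgebra K a' 0 b') (ϖ : K) → (2 * algebraMap (NumberField.RingOfIntegers F) (NumberField.RingOfIntegers K) (a * b) * (Nat.card A : NumberField.RingOfIntegers K)) ∉ v.asIdeal → ∀ 𝔓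 ∈ v.primesAbove, (∀ τ ∈ 𝔓.inertia (Field.absoluteGaloisGroup K), ∀ s, t (s * τ) = t s ∧ d (s * τ) = d s) ∧ ∀ s, IsArithFrobAt (NumberField.RingOfIntegers K) s 𝔓 → HR c g (t s) ∧ d s = (v.residueCard : A)

/-- item stmt-Langlands-13532 · crux · rank 5 · open · by planner
why it might fail: Unrefutable as typed (implied by ThetaVisibleConjA); as proof node it breaks if Θ(c)≡0 for a theta-visible torsion c (torsion KM-injectivity / theta dichotomy, first occurrence in genus 3; Roberts2001 needs non-vanishing) or if torsion pseudo-reps for wt-2 Hilbert–Siegel systems over F≠ℚ stay open.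
sources: Roberts2001, HarrisSoudryTaylor1993, Taylor1991, arXiv:1507.05922, GoldringKoskivirta2019, EmertonReduzziXiao2017
[crux] THE ENGINE COMPLETION: TorsionKudlaMillsonModularity → ThetaInertAnnihilation →
ThetaVisibleConjA. Content: (i) the split-prime Hecke relation T(ϖ_v)Θ(c) = Θ(T_w c) + Θ(T_{w^σ} c)
for v = w·w^σ (cycle-level Eichler relation, the companion of crux 3); (ii) NON-VANISHING of Θ(c)
for theta-visible c (torsion analogue of the injectivity of the Kudla–Millson lift, Bruinier–Funke /
Kiefer–Zuffetti doi:10.1017/s0010437x2610308x in char 0; theta dichotomy for (O(V'), Sp₄)); (iii)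
Galois pseudo-representations over F attached to mod-p^m Hecke eigensystems in
hilbertSiegelModularFormModN of parallel weight (char 0 over ℚ: Taylor1991; torsion coherent
cohomology of Hodge-type Hilbert–Siegel varieties: arXiv:1507.05922, GoldringKoskivirta2019,
EmertonReduzziXiao2017-type); (iv) EXTRACTION of (t, d) over K from the 4-dimensional
pseudo-representation over F (R ≅ R ⊗ ε_{K/F}; HarrisSoudryTaylor1993 §3 twisting, Taylor1994,
BergerHarcos2007), with the T_w-eigenvalues read off through (i) and crux 3. The division hypothesis
excludes the Bianchi/matrix case, so Scholze2015 is no shortcut. [deps: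
TorsionKudlaMillsonModularity, ThetaInertAnnihilation] [difficulty: XL] -/
@[route_item "route-Langlands-TorsionKudlaMillsonWindow", crux]
def ThetaEngineCompletion : Prop :=
  TorsionKudlaMillsonModularity → ThetaInertAnnihilation → ThetaVisibleConjA

/-- item stmt-Langlands-13533 · crux · rank 6 · open · by planner
why it might fail: Nothing forces a p-torsion character of a cocompact Γ¹ to see an F-trace geodesic: Calegari–Dunfield-type towers (K=ℚ(√−2), B₀ of disc 15, in this family) have b₁=0 and exponential H₁-torsion (BergeronVenkatesh2012); even rationally, spanning H₁ mod congruence needs theta non-vanishing (Roberts2001)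
sources: BergeronVenkatesh2012, MarshallMuller2013, Roberts2001, HarrisSoudryTaylor1993, KudlaMillson1990, BergeronMillsonMoeglin2016
[crux] NON-DEGENERACY of the torsion theta kernel (gen-1 crux, refuter-checked encoding, frame
updated): for some N ≥ 1 every norm-one unit of O congruent to 1 mod N·O lies in the subgroup
generated by the theta-visible elements (norm-one units of infinite order with reduced trace in F)
and the commutators of Γ = O^×; equivalently every character of Γ that kills the holonomy of every
special geodesic is a congruence (Eisenstein) character. Repaired in gen 1 against the
residual-torus obstruction at primes dividing a inert in K/F (hence the slack N and the restriction
to norm one). Rational content: Kudla–Millson classes span H₁(Γ¹\H³, ℚ) modulo congruence homology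
(KM injectivity + HST/Roberts non-vanishing, modulo theta dichotomy) — not in print as stated;
torsion content new. The Bianchi version of gen 1 (FTraceGenerationBianchi) was shown trivially true
by unipotents (refuter 79b8ea41-0 evidence on stmt-Langlands-3121); Γ here is cocompact, has no
parabolics, and that argument does not transfer. [difficulty: L] -/
@[route_item "route-Langlands-TorsionKudlaMillsonWindow", crux]
def FTraceCongruenceGeneration : Prop :=
  ∀ (F K : Type) [Field F] [NumberField F] [Field K] [NumberField K] [Algebra F K] (σ : K ≃ₐ[F] K) (a b : NumberField.RingOfIntegers F), NumberField.IsTotallyReal F → Module.finrank F K = 2 → σ ≠ 1 → NumberField.InfinitePlace.nrComplexPlaces K = 1 → a ≠ 0 → b ≠ 0 → (∀ φ : K →+* ℂ, (starRingEnd ℂ).comp φ = φ → (φ (algebraMap F K a)).re < 0 ∧ (φ (algebraMap F K b)).re < 0) → (∀ φ : K →+* ℂ, (starRingEnd ℂ).comp φ ≠ φ → 0 < (φ (algebraMap F K a)).re ∨ 0 < (φ (algebraMap F K b)).re) → let a' : K := algebraMap F K a; let b' : K := algebraMap F K b; (∀ y : QuaternionAlgebra K a' 0 b', y * star y = 0 →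 y = 0) → let IsInt : QuaternionAlgebra K a' 0 b' → Prop := fun x => ∀ i : Fin 4, QuaternionAlgebra.equivTuple a' 0 b' x i ∈ Set.range (algebraMap (NumberField.RingOfIntegers K) K); let IsG : (QuaternionAlgebra K a' 0 b')ˣ → Prop := fun u => IsInt (u : QuaternionAlgebra K a' 0 b') ∧ IsInt ((u⁻¹ : (QuaternionAlgebra K a' 0 b')ˣ) : QuaternionAlgebra K a' 0 b'); let Cong : ℕ → (QuaternionAlgebra K a' 0 b')ˣ → Prop := fun N u => IsG u ∧ ∀ i : Fin 4, QuaternionAlgebra.equivTuple a' 0 b' ((u : QuaternionAlgebra K a' 0 b') - 1) i ∈ Set.range (fun y : NumberField.RingOfIntegers K => (((N : NumberField.RingOfIntegers K) * y : NumberField.RingOfIntegers K) : K)); let FTr : (QuaternionAlgebra K a' 0 b')ˣ → Prop := fun u => IsG u ∧ (u : QuaternionAlgebra K a' 0 b') * star (u : QuaternionAlgebra K a' 0 b') = 1 ∧ σ (u : QuaternionAlgebra K a' 0 b').re = (u : QuaternionAlgebra K a' 0 b').re ∧ ¬ IsOfFinOrder u; ∃ N : ℕ, 0 < N ∧ ∀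 γ, Cong N γ → (γ : QuaternionAlgebra K a' 0 b') * star (γ : QuaternionAlgebra K a' 0 b') = 1 → γ ∈ Subgroup.closure ({u | FTr u} ∪ {w | ∃ u v, IsG u ∧ IsG v ∧ w = u * v * u⁻¹ * v⁻¹})

/-- item stmt-Langlands-13534 · support · rank 9 · open · by planner
sources: CalegariVenkatesh2019, Chevalley1951, Shimura1971, arXiv:1212.3847
[support] EISENSTEIN / CONGRUENCE complement (gen-1 item, retriaged support): the conclusion of X
for eigen-characters c that vanish on a norm-one principal congruence subgroup Γ¹(N) = {u ∈ O^× : u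
≡ 1 mod N·O, u ū = 1}. Such c factor through O^×/Γ¹(N) (an extension of a finite congruence quotient
by unit norms) and are Galois-Eisenstein: c = ψ∘nrd has T_v-eigenvalue q_v + 1 and (t, d) = (1 +
χ_cyc, χ_cyc) mod |A| works; in general t = χ₁ + χ₂ from class field theory of K. Proof weight only
(quadratic class field theory over K, ModNCyclotomicCharacter in the tree), not truth. [difficulty:
M] -/
@[route_item "route-Langlands-TorsionKudlaMillsonWindow", crux]
def EisensteinConjA : Prop :=
  ∀ (F K : Type) [Field F] [NumberField F] [Field K] [NumberField K] [Algebra F K] (σ : K ≃ₐ[F] K) (a b : NumberField.RingOfIntegers F), NumberField.IsTotallyReal F → Module.finrank F K = 2 → σ ≠ 1 → NumberField.InfinitePlace.nrComplexPlaces K = 1 → a ≠ 0 → b ≠ 0 → (∀ φ : K →+* ℂ, (starRingEnd ℂ).comp φ = φ → (φ (algebraMap F K a)).re < 0 ∧ (φ (algebraMap F K b)).re < 0) → (∀ φ : K →+* ℂ, (starRingEnd ℂ).comp φ ≠ φ → 0 < (φ (algebraMap F K a)).re ∨ 0 < (φ (algebraMap F K b)).re) → let a' : K := algebraMap F K a;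 let b' : K := algebraMap F K b; (∀ y : QuaternionAlgebra K a' 0 b', y * star y = 0 → y = 0) → let IsInt : QuaternionAlgebra K a' 0 b' → Prop := fun x => ∀ i : Fin 4, QuaternionAlgebra.equivTuple a' 0 b' x i ∈ Set.range (algebraMap (NumberField.RingOfIntegers K) K); let IsG : (QuaternionAlgebra K a' 0 b')ˣ → Prop := fun u => IsInt (u : QuaternionAlgebra K a' 0 b') ∧ IsInt ((u⁻¹ : (QuaternionAlgebra K a' 0 b')ˣ) : QuaternionAlgebra K a' 0 b'); let Cong : ℕ → (QuaternionAlgebra K a' 0 b')ˣ → Prop := fun N u => IsG u ∧ ∀ i : Fin 4, QuaternionAlgebra.equivTuple a' 0 b' ((u : QuaternionAlgebra K a' 0 b') - 1) i ∈ Set.range (fun y : NumberField.RingOfIntegers K => (((N : NumberField.RingOfIntegers K) * y : NumberField.RingOfIntegers K) : K)); ∀ (A : Type) [CommRing A] [Finite A], let HR : ((QuaternionAlgebra K a' 0 b')ˣ → A) → (QuaternionAlgebra K a' 0 b')ˣ → A → Prop := fun c g l => ∃ (k : ℕ) (r : Fin k → (QuaternionAlgebra K a' 0 b')ˣ), (∀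 i, ∃ γ₁ γ₂, IsG γ₁ ∧ IsG γ₂ ∧ r i = γ₁ * g * γ₂) ∧ (∀ γ₁ γ₂, IsG γ₁ → IsG γ₂ → ∃! i, ∃ γ, IsG γ ∧ γ₁ * g * γ₂ = γ * r i) ∧ (∀ γ, IsG γ → ∀ (s : Fin k → Fin k) (e : Fin k → (QuaternionAlgebra K a' 0 b')ˣ), (∀ i, IsG (e i) ∧ r i * γ = e i * r (s i)) → ∑ i, c (e i) = l * c γ); let PR : (Field.absoluteGaloisGroup K → A) → (Field.absoluteGaloisGroup K → A) → Prop := fun t d => t 1 = 2 ∧ d 1 = 1 ∧ (∀ x y, d (x * y) = d x * d y) ∧ (∀ x y, t (x * y) = t (y * x)) ∧ (∀ x y, t x * t y = t (x * y) + d y * t (x * y⁻¹)) ∧ IsLocallyConstant t ∧ IsLocallyConstant d; ∀ (c : (QuaternionAlgebra K a' 0 b')ˣ → A), (∀ x y, IsG x → IsG y → c (x * y) = c x + c y) → (∀ u, IsG u → (u : QuaternionAlgebra K a' 0 b') ∈ Set.range (algebraMap K (QuaternionAlgebra K a' 0 b')) → c u = 0) → (∃ N : ℕ, 0 < N ∧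 ∀ γ, Cong N γ → (γ : QuaternionAlgebra K a' 0 b') * star (γ : QuaternionAlgebra K a' 0 b') = 1 → c γ = 0) → (∀ (ϖ : NumberField.RingOfIntegers K) (g : (QuaternionAlgebra K a' 0 b')ˣ) (v : IsDedekindDomain.HeightOneSpectrum (NumberField.RingOfIntegers K)), Prime ϖ → v.asIdeal = Ideal.span {ϖ} → IsInt (g : QuaternionAlgebra K a' 0 b') → (g : QuaternionAlgebra K a' 0 b') * star (g : QuaternionAlgebra K a' 0 b') = algebraMap K (QuaternionAlgebra K a' 0 b') (ϖ : K) → (2 * algebraMap (NumberField.RingOfIntegers F) (NumberField.RingOfIntegers K) (a * b) * (Nat.card A : NumberField.RingOfIntegers K)) ∉ v.asIdeal → ∃ l : A, HR c g l) → ∃ t d : Field.absoluteGaloisGroup K → A, PR t d ∧ ∀ (ϖ : NumberField.RingOfIntegers K) (g : (QuaternionAlgebra K a' 0 b')ˣ) (v : IsDedekindDomain.HeightOneSpectrum (NumberField.RingOfIntegers K)), Prime ϖ → v.asIdeal = Ideal.span {ϖ} → IsInt (g : QuaternionAlgebra K a' 0 b') → (g : QuaternionAlgebra K a' 0 b') *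 star (g : QuaternionAlgebra K a' 0 b') = algebraMap K (QuaternionAlgebra K a' 0 b') (ϖ : K) → (2 * algebraMap (NumberField.RingOfIntegers F) (NumberField.RingOfIntegers K) (a * b) * (Nat.card A : NumberField.RingOfIntegers K)) ∉ v.asIdeal → ∀ 𝔓 ∈ v.primesAbove, (∀ τ ∈ 𝔓.inertia (Field.absoluteGaloisGroup K), ∀ s, t (s * τ) = t s ∧ d (s * τ) = d s) ∧ ∀ s, IsArithFrobAt (NumberField.RingOfIntegers K) s 𝔓 → HR c g (t s) ∧ d s = (v.residueCard : A)

/-- item stmt-Langlands-13535 · support · rank 9 · closed · proved by Summit.Langlands.Langlands.Theorems.TorsionKudlaMillsonWindowDichotomy.windowDichotomy_proof (prover) · by planner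
sources: VignerasLNM800, Shimura1971
[support] The glue ThetaVisibleConjA → FTraceCongruenceGeneration → EisensteinConjA →
ConjAWindowTheta: a centre-trivial eigen-character either sees an F-trace loxodromic
(ThetaVisibleConjA applies) or kills all of them; being additive on the subgroup O^× ('IsG is a
subgroup': the coordinates of a product are O_K-bilinear in the coordinates since a, b ∈ O_F — c. 30
lines) it kills commutators, hence the closure in FTraceCongruenceGeneration, hence Γ¹(N), and
EisensteinConjA applies. Pure logic plus that lemma; term-mode skeleton in the planner's
Sketch.lean. [difficulty: provable-now] -/
@[route_item "route-Langlands-TorsionKudlaMillsonWindow", crux]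
def WindowDichotomy : Prop :=
  ThetaVisibleConjA → FTraceCongruenceGeneration → EisensteinConjA → ConjAWindowTheta

-- `WindowDichotomy` holds: proved by `Summit.Langlands.Langlands.Theorems.TorsionKudlaMillsonWindowDichotomy.windowDichotomy_proof` (its module imports this route file, so no `_holds` link can be stated here).

/-- item stmt-Langlands-13536 · support · rank 9 · open · by planner
sources: CalegariGeraghty2017, BuzzardGeeLMS2014, Taylor1991, HarrisSoudryTaylor1993
[support] RESIDUAL, declared and NOT attacked by this route: ConjAWindowTheta → Langlands — the rest
of the summit given X. Inside the window for n = 2 its intended content is Calegari–Geraghty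
patching in defect l₀ = 1 (CalegariGeraghty2017: Conj. A with local–global compatibility + Conj. B,
automatic for compact 3-manifolds, ⟹ minimal modularity lifting), fed by X upgraded to all
unramified places and to p | level, Taylor's potential residual automorphy for GL₂, characteristic-0
Jacquet–Langlands back to GL₂/K (direction (B) over the window), and the ℓ-adic limit of X
(Taylor1991 gluing) for direction (A), which in characteristic 0 is largely known for n = 2
(HarrisSoudryTaylor1993, BergerHarcos2007, Mok2014, BoxerEtAl2021); everything else (other fields, n
≥ 3, compatibility at every place, de Rham) is untouched. Listed only so that the deciding theorem
is an honest implication whose mathematical content is exactly 'cruxes ⟹ X'; a sector route on an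
all-fields/all-ranks summit cannot do better, and refuters should grade the target and the cruxes
(pattern of route-Langlands-QuadraticWindow, BeyondTheWindow). [difficulty: open-problem] -/
@[route_item "route-Langlands-TorsionKudlaMillsonWindow", crux]
def BeyondTorsionWindow : Prop :=
  ConjAWindowTheta → Langlands

/-- item stmt-Langlands-18922 · support · rank 9 · closed · proved by Summit.Langlands.Langlands.Theorems.TorsionKudlaMillsonWindowTorsionTraceFinite.torsionTraceFinite_proof (prover) · by planner
sources: MaclachlanReid2003, VignerasLNM800
[support] TORSION CONTROL BY TRACES: the real parts re(u) = trd(u)/2 of the finite-order elements u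
of Γ¹ = O¹ lie in a finite subset of K (u of order n generates a commutative subfield K(u) ⊂ B with
[K(u):ℚ] ≤ 2[K:ℚ] containing a primitive n-th root of unity, so φ(n) ≤ 2[K:ℚ] bounds n, and re(u) =
(ζ+ζ⁻¹)/2; or u = ±1). Known in print (MaclachlanReid2003 Ch. 12, VignerasLNM800 IV §1); provable
now; used contrapositively in the assembly: an F-trace element with re ∉ T has infinite order. -/
@[route_item "route-Langlands-TorsionKudlaMillsonWindow"]
def TorsionTraceFinite : Prop :=
  ∀ (F K : Type) [Field F] [NumberField F] [Field K] [NumberField K] [Algebra F K] (σ : K ≃ₐ[F] K) (a b : NumberField.RingOfIntegers F), NumberField.IsTotallyReal F → Module.finrank F K = 2 → σ ≠ 1 → NumberField.InfinitePlace.nrComplexPlaces K = 1 → a ≠ 0 → b ≠ 0 → (∀ φ : K →+* ℂ, (starRingEnd ℂ).comp φ = φ → (φ (algebraMap F K a)).re < 0 ∧ (φ (algebraMap F K b)).re < 0) → (∀ φ : K →+* ℂ, (starRingEnd ℂ).comp φ ≠ φ → 0 < (φ (algebraMap F K a)).re ∨ 0 < (φ (algebraMap F K b)).re) → let a' : K :=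 algebraMap F K a; let b' : K := algebraMap F K b; (∀ y : QuaternionAlgebra K a' 0 b', y * star y = 0 → y = 0) → let IsInt : QuaternionAlgebra K a' 0 b' → Prop := fun x => ∀ i : Fin 4, QuaternionAlgebra.equivTuple a' 0 b' x i ∈ Set.range (algebraMap (NumberField.RingOfIntegers K) K); let IsG : (QuaternionAlgebra K a' 0 b')ˣ → Prop := fun u => IsInt (u : QuaternionAlgebra K a' 0 b') ∧ IsInt ((u⁻¹ : (QuaternionAlgebra K a' 0 b')ˣ) : QuaternionAlgebra K a' 0 b'); ∃ T : Finset K, ∀ u : (QuaternionAlgebra K a' 0 b')ˣ, IsG u → (u : QuaternionAlgebra K a' 0 b') * star (u : QuaternionAlgebra K a' 0 b') = 1 → IsOfFinOrder u → (u : QuaternionAlgebra K a' 0 b').re ∈ T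

-- `TorsionTraceFinite` holds: proved by `Summit.Langlands.Langlands.Theorems.TorsionKudlaMillsonWindowTorsionTraceFinite.torsionTraceFinite_proof` (its module imports this route file, so no `_holds` link can be stated here).

/-- item stmt-Langlands-18924 · support · rank 9 · closed · proved by Summit.Langlands.Langlands.Theorems.TorsionKudlaMillsonWindowFTraceCongruenceGenerationOfPieces.fTraceCongruenceGenerationOfPieces_proof (prover) · by planner
sources: VignerasLNM800
[support] GLUE of the strategist's BC2-redirect decomposition of FTraceCongruenceGeneration
(stmt-Langlands-13533): CosetFTraceTwist → TorsionTraceFinite → CongruenceCosetCapture →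
FTraceCongruenceGeneration (strategist BC2-redirect assembly, proved sorry-free in the seat's
Sketch.lean `fTraceCongruenceGeneration_of_pieces`, 60 tactic lines): the finite torsion-trace set T
of TorsionTraceFinite is fed to CosetFTraceTwist, which returns the exceptional square classes C,
the level M and the base point x; these are fed to CongruenceCosetCapture, which returns M'. For γ ∈
Γ¹(M'): γ = t₁⁻¹t₂ (tᵢ ∈ Good), tᵢ = (tᵢuᵢ)uᵢ⁻¹ with uᵢ ∈ O₀¹ and tᵢuᵢ of F-trace, all four of
infinite order by T, hence γ = u₁(t₁u₁)⁻¹(t₂u₂)u₂⁻¹ ∈ ⟨FTr⟩ (closure under products via Literature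
QuaternionCoordOrder.normOneGroup; the commutator generators are not needed). -/
@[route_item "route-Langlands-TorsionKudlaMillsonWindow"]
def FTraceCongruenceGenerationOfPieces : Prop :=
  CosetFTraceTwist → TorsionTraceFinite → CongruenceCosetCapture → FTraceCongruenceGeneration

-- `FTraceCongruenceGenerationOfPieces` holds: proved by `Summit.Langlands.Langlands.Theorems.TorsionKudlaMillsonWindowFTraceCongruenceGenerationOfPieces.fTraceCongruenceGenerationOfPieces_proof` (its module imports this route file, so no `_holds` link can be stated here).

/-- item stmt-Langlands-13537 · assembly · rank 1 · closed · proved by Summit.Langlands.Langlands.Theorems.torsionKudlaMillsonWindow_assembly_proof (prover) · by planner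
sources: CalegariGeraghty2017, KudlaMillson1990
[assembly] TorsionKudlaMillsonModularity → ThetaInertAnnihilation → ThetaEngineCompletion →
FTraceCongruenceGeneration → EisensteinConjA → WindowDichotomy → BeyondTorsionWindow → Langlands. -/
@[route_item "route-Langlands-TorsionKudlaMillsonWindow"]
def Assembly : Prop :=
  TorsionKudlaMillsonModularity → ThetaInertAnnihilation → ThetaEngineCompletion → FTraceCongruenceGeneration → EisensteinConjA → WindowDichotomy → BeyondTorsionWindow → Langlands

-- `Assembly` holds: proved by `Summit.Langlands.Langlands.Theorems.torsionKudlaMillsonWindow_assembly_proof` (its module imports this route file, so no `_holds` link can be stated here).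

/-! D-0027 §2.1 — DECIDING THEOREM (planner-authored via `route open/edit --closes-file`; by planner-plancard-Langlands-Langlands-torsion--be042e3d-g2-0 2026-08-15T19:20:59Z):
its hypotheses are this route's items and its conclusion the sub-problem Statement (glue_lint), and it elaborates with this file. -/

@[closes "route-Langlands-TorsionKudlaMillsonWindow"] theorem closes (tkm : TorsionKudlaMillsonModularity) (inert : ThetaInertAnnihilation)
    (engine : ThetaEngineCompletion) (gen : FTraceCongruenceGeneration) (eis : EisensteinConjA)
    (dich : WindowDichotomy) (beyond : BeyondTorsionWindow) : Langlands :=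
  beyond (dich (engine tkm inert) gen eis)

end Summit.Langlands.Langlands.Theses.TorsionKudlaMillsonWindow
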